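import Literature.Algebra.EuclideanLattices.MRCombiningProcedure
import Mathlib.Algebra.Module.ZLattice.Basic
import Mathlib.GroupTheory.QuotientGroup.Defs
import Mathlib.Data.ZMod.Basic
import HarnessLib

/-!
# The fine grid of the Micciancio–Regev reductions: `L' = L(S)/M`, its coordinates modulo `M`, and the combining procedure on it

Topic `Algebra/EuclideanLattices` (family `pqc`). The concrete finite model in which a bit-level
rendering of Micciancio–Regev 2007, Thm. 5.9 (`IncGDD → SIS`) and Thm. 5.23 (`GapCVP′ → SIS′`) runs
the sampling procedure of Lemma 5.7 and the combining procedure of Lemma 5.8 (authors' version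
pp. 20–21; "all arguments can be made rigorous by a sufficiently fine grid", p. 8). This is the model
left open by `GaussianSublatticeUniformity.lean` ("the choice `L' = L(S)/M` … to be done") and
assumed abstractly by `MRCombiningQuery.lean` (`G = (ℤ/Mℤ)ⁿ`, `ψ : G →+ Q`, `rep`); written for the
decomposition of `Literature.Computability.Cryptography.MicciancioRegev2007_gapCVP'_to_SIS'` and of
the machine-level Cor. 5.13 behind `Literature.Computability.Cryptography.owfExist_of_gapSVP_worstCaseHard`.

Data: a real basis `b = (b₀, …, b_{n-1})` of `V` — the FINE-GRID basis, `bⱼ = sⱼ/M` for the given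
linearly independent lattice vectors `S = (sⱼ)` and the grid parameter `M` (in the reductions
`M = q·d`) — and a lattice `L ⊆ V` with `sⱼ = M • bⱼ ∈ L ⊆ L' := span_ℤ b` (the second inclusion is
the divisibility condition on `M` that the caller arranges).

* `MicciancioRegev2007.gridCoord b M : L' →+ (Fin n → ZMod M)` — the coordinates of a grid vector
  modulo `M`; `gridCoord_eq_zero_iff_mem` — its kernel is `L(S) = span_ℤ (M • b)`;
  `gridCoord_surjective`.
* `MicciancioRegev2007.gridRep b M w : L'` — the representative `∑ⱼ val(wⱼ) • bⱼ` of a class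
  `w ∈ (ℤ/Mℤ)ⁿ` (MR07's reduction "`mod P(S)`" into the parallelepiped `P(S)`: `b`-coordinates in
  `[0, M)`, i.e. `S`-coordinates `val(wⱼ)/M ∈ [0,1)`); `gridCoord_gridRep`, `repr_gridRep`.
* `MicciancioRegev2007.gridImage b M L` — the subgroup `H = L/L(S)` of `(ℤ/Mℤ)ⁿ` (image of `L ∩ L'`),
  and `MicciancioRegev2007.gridClass b M L : L' →+ (ℤ/Mℤ)ⁿ ⧸ H` — the class map with kernel exactly
  `L` (`gridClass_eq_zero_iff`, the `φ`/`hker` of `GaussianSublatticeUniformity`) and onto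
  (`gridClass_surjective`); the quotient map `QuotientAddGroup.mk' H` is the `ψ` of
  `MRCombiningQuery` (kernel `H`, `QuotientAddGroup.ker_mk'`), and `gridClass = ψ ∘ gridCoord`.
* `MicciancioRegev2007.coe_sub_coe_gridRep_mem` — **consistency of the two procedures**: for a grid
  vector `c` (the offset representative of Lemma 5.7) and `h ∈ H` ("`v ∈ L(B) mod P(S)`"), the
  vector `w = gridRep (gridCoord c + h)` satisfies `c − w ∈ L` — the hypothesis `cᵢ − wᵢ ∈ L(B)` of
  `MicciancioRegev2007.combine_mem`.
* `MicciancioRegev2007.combine_mem_grid`, `norm_combine_sub_le_grid` — **Lemma 5.8 (ii), (iii) on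
  the grid** with `M = q·d`: the query entry is `aᵢⱼ = ⌊val(wᵢⱼ)/d⌋` (`= ⌊q · S⁻¹wᵢ⌋ⱼ`), the output
  `x = ∑ᵢ zᵢ (cᵢ − wᵢ) + ∑ⱼ ((∑ᵢ zᵢ aᵢⱼ)/q) • sⱼ` lies in `L` when `A z ≡ 0 (mod q)`, and
  `‖x − C z‖ ≤ n √m ‖z‖ σ / q` for `‖sⱼ‖ ≤ σ` (instantiating `MRCombiningProcedure` at the basis
  `S = M • b`).

## References

* D. Micciancio, O. Regev, *Worst-case to average-case reductions based on Gaussian measures*,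
  SIAM J. Comput. 37 (2007) 267–302; authors' version (`lit read doi:10.1137/S0097539705447360`),
  Lemma 5.7–5.8 and proofs (pp. 20–21), the grid convention (p. 8).
-/

noncomputable section

open Finset Module Submodule

namespace Literature.Algebra.EuclideanLattices

namespace MicciancioRegev2007

variable {V : Type*} [NormedAddCommGroup V] [NormedSpace ℝ V] {n : ℕ} (b : Basis (Fin n) ℝ V) (M : ℕ)

/-! ### Integer coordinates on the fine grid -/

/-- The integer coordinate of a grid vector, read in `ℝ`, is its real coordinate. [folklore] -/
theorem cast_restrictScalars_repr (x : span ℤ (Set.range b)) (j : Fin n) :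
    (((b.restrictScalars ℤ).repr x j : ℤ) : ℝ) = b.repr x j := by
  rw [← b.restrictScalars_repr_apply ℤ x j, eq_intCast]

/-- A grid vector is the integer combination of the `bⱼ` with its integer coordinates. [folklore] -/
theorem coe_eq_sum_repr_smul (x : span ℤ (Set.range b)) :
    (x : V) = ∑ j, (((b.restrictScalars ℤ).repr x j : ℤ) : ℝ) • b j := by
  conv_lhs => rw [← b.sum_repr (x : V)]
  exact Finset.sum_congr rfl fun j _ => by rw [cast_restrictScalars_repr]

/-- **The coordinates of a grid vector modulo `M`**: `x = ∑ⱼ kⱼ bⱼ ↦ (kⱼ mod M)ⱼ ∈ (ℤ/Mℤ)ⁿ` — the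
identification `L'/L(S) ≅ (ℤ/Mℤ)ⁿ` of the fine grid `L' = L(S)/M` modulo `L(S)` (`sⱼ = M bⱼ`).
[cite: MicciancioRegev2007, Lemma 5.8 (proof, p. 21: "`wᵢ = vᵢ + cᵢ mod P(S)`", on the grid of p. 8)] -/
def gridCoord : span ℤ (Set.range b) →+ (Fin n → ZMod M) where
  toFun x j := (((b.restrictScalars ℤ).repr x j : ℤ) : ZMod M)
  map_zero' := by
    funext j
    simp
  map_add' x y := by
    funext j
    simp

/-- Unfolding `gridCoord`. [folklore] -/
@[simp]
theorem gridCoord_apply (x : span ℤ (Set.range b)) (j : Fin n) :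
    gridCoord b M x j = (((b.restrictScalars ℤ).repr x j : ℤ) : ZMod M) := rfl

/-- **The kernel of `gridCoord` in coordinates**: all integer coordinates are divisible by `M`.
[folklore] -/
theorem gridCoord_eq_zero_iff (x : span ℤ (Set.range b)) :
    gridCoord b M x = 0 ↔ ∀ j, (M : ℤ) ∣ (b.restrictScalars ℤ).repr x j := by
  simp only [funext_iff, gridCoord_apply, Pi.zero_apply, ZMod.intCast_zmod_eq_zero_iff_dvd]

/-- **The kernel of `gridCoord` is `L(S) = span_ℤ (M • b)`.** [cite: MicciancioRegev2007, Lemma 5.8 (proof, p. 21)] -/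
theorem gridCoord_eq_zero_iff_mem [NeZero M] (x : span ℤ (Set.range b)) :
    gridCoord b M x = 0 ↔ (x : V) ∈ span ℤ (Set.range fun j => (M : ℝ) • b j) := by
  rw [gridCoord_eq_zero_iff]
  constructor
  · intro h
    rw [coe_eq_sum_repr_smul b x]
    refine sum_mem fun j _ => ?_
    obtain ⟨k, hk⟩ := h j
    rw [hk, Int.cast_mul, Int.cast_natCast, mul_comm, ← smul_smul, Int.cast_smul_eq_zsmul]
    exact zsmul_mem (subset_span (Set.mem_range_self j)) k
  · intro h j
    -- read the `M • b`-coordinates: they are the `b`-coordinates divided by `M`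
    have hM : (M : ℝ) ≠ 0 := by exact_mod_cast NeZero.ne M
    have hunit : ∀ _j : Fin n, IsUnit (M : ℝ) := fun _ => isUnit_iff_ne_zero.2 hM
    have hrange : (Set.range fun j => (M : ℝ) • b j) = Set.range (b.isUnitSMul hunit) := by
      ext v; simp [Basis.isUnitSMul_apply]
    rw [hrange, Basis.mem_span_iff_repr_mem] at h
    obtain ⟨k, hk⟩ := h j
    rw [Basis.repr_isUnitSMul, eq_intCast] at hk
    refine ⟨k, ?_⟩
    have h1 : ((hunit j).unit⁻¹ : ℝˣ) • b.repr (x : V) j = (M : ℝ)⁻¹ * b.repr (x : V) j := by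
      rw [Units.smul_def, smul_eq_mul, Units.val_inv_eq_inv_val, IsUnit.unit_spec]
    rw [h1] at hk
    have h2 : b.repr (x : V) j = (M : ℝ) * k := by
      field_simp at hk
      linarith [hk]
    have h3 : (((b.restrictScalars ℤ).repr x j : ℤ) : ℝ) = ((M * k : ℤ) : ℝ) := by
      rw [cast_restrictScalars_repr, h2]; push_cast; ring
    exact_mod_cast h3

/-! ### Representatives in `P(S)` -/

/-- **The representative of a class in the parallelepiped `P(S)`**: `gridRep w = ∑ⱼ val(wⱼ) • bⱼ`
(`b`-coordinates in `[0, M)`, i.e. `S`-coordinates `val(wⱼ)/M ∈ [0, 1)`; MR07's "`mod P(S)`").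
[cite: MicciancioRegev2007, Lemma 5.8 (proof, p. 21)] -/
def gridRep (w : Fin n → ZMod M) : span ℤ (Set.range b) :=
  ∑ j, ((w j).val : ℤ) • b.restrictScalars ℤ j

/-- The integer coordinates of `gridRep w` are the `val(wⱼ)`. [folklore] -/
@[simp]
theorem restrictScalars_repr_gridRep (w : Fin n → ZMod M) (j : Fin n) :
    (b.restrictScalars ℤ).repr (gridRep b M w) j = (w j).val := by
  simp only [gridRep, map_sum, map_zsmul, Basis.repr_self, Finsupp.coe_finsetSum, Finsupp.coe_smul,
    Finset.sum_apply, Pi.smul_apply, Finsupp.single_apply, smul_eq_mul, mul_ite, mul_one, mul_zero,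
    Finset.sum_ite_eq', Finset.mem_univ, if_true]

/-- `gridRep` is a section of `gridCoord`. [folklore] -/
@[simp]
theorem gridCoord_gridRep [NeZero M] (w : Fin n → ZMod M) : gridCoord b M (gridRep b M w) = w := by
  funext j
  rw [gridCoord_apply, restrictScalars_repr_gridRep, Int.cast_natCast, ZMod.natCast_zmod_val]

/-- `gridCoord` is onto `(ℤ/Mℤ)ⁿ`. [folklore] -/
theorem gridCoord_surjective [NeZero M] : Function.Surjective (gridCoord b M) :=
  fun w => ⟨gridRep b M w, gridCoord_gridRep b M w⟩

/-- The vector `gridRep w` is `∑ⱼ val(wⱼ) • bⱼ`. [folklore] -/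
theorem coe_gridRep (w : Fin n → ZMod M) : (gridRep b M w : V) = ∑ j, ((w j).val : ℝ) • b j := by
  rw [coe_eq_sum_repr_smul b (gridRep b M w)]
  exact Finset.sum_congr rfl fun j _ => by rw [restrictScalars_repr_gridRep]; push_cast; rfl

/-- The real `b`-coordinates of `gridRep w` are the `val(wⱼ) ∈ [0, M)`. [folklore] -/
theorem repr_coe_gridRep (w : Fin n → ZMod M) (j : Fin n) : b.repr (gridRep b M w : V) j = (w j).val := by
  rw [← cast_restrictScalars_repr, restrictScalars_repr_gridRep, Int.cast_natCast]

/-! ### The lattice `L` between `L(S)` and `L'`: its image `H` and the class map with kernel `L` -/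

variable (L : Submodule ℤ V)

/-- **The subgroup `H = L/L(S)` of `(ℤ/Mℤ)ⁿ`**: the image under `gridCoord` of the grid vectors lying
in `L` (MR07's "lattice vectors `v ∈ L(B) mod P(S)`"; the `ker ψ` of `MRCombiningQuery`).
[cite: MicciancioRegev2007, Lemma 5.8 (proof, p. 21, step 1 of `A_F`)] -/
def gridImage : AddSubgroup (Fin n → ZMod M) :=
  (L.toAddSubgroup.addSubgroupOf (span ℤ (Set.range b)).toAddSubgroup).map (gridCoord b M)

/-- Membership in `H`: `h ∈ H` iff `h = gridCoord x` for a grid vector `x ∈ L`. [folklore] -/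
theorem mem_gridImage_iff (h : Fin n → ZMod M) :
    h ∈ gridImage b M L ↔ ∃ x : span ℤ (Set.range b), (x : V) ∈ L ∧ gridCoord b M x = h := by
  rw [gridImage, AddSubgroup.mem_map]
  exact ⟨fun ⟨x, hx, hx'⟩ => ⟨x, hx, hx'⟩, fun ⟨x, hx, hx'⟩ => ⟨x, hx, hx'⟩⟩

/-- **The class map `φ : L' → (ℤ/Mℤ)ⁿ ⧸ H`** (`= ψ ∘ gridCoord` with `ψ` the quotient map): the offset
class of a grid vector, MR07's "`c = -r mod P(B)`" read in the finite group `L'/L`.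
[cite: MicciancioRegev2007, Lemma 5.7 (proof, p. 20), on the grid of p. 8] -/
def gridClass : span ℤ (Set.range b) →+ (Fin n → ZMod M) ⧸ gridImage b M L :=
  (QuotientAddGroup.mk' (gridImage b M L)).comp (gridCoord b M)

/-- Unfolding `gridClass`. [folklore] -/
theorem gridClass_apply (x : span ℤ (Set.range b)) :
    gridClass b M L x = QuotientAddGroup.mk' (gridImage b M L) (gridCoord b M x) := rfl

/-- **The kernel of the class map is exactly `L`** (given `L(S) ⊆ L`): the hypothesis `hker` of
`GaussianSublatticeUniformity` for `φ = gridClass`. [cite: MicciancioRegev2007, Lemma 5.7–5.8 (pp. 20–21)] -/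
theorem gridClass_eq_zero_iff [NeZero M] (hSL : ∀ j, (M : ℝ) • b j ∈ L) (x : span ℤ (Set.range b)) :
    gridClass b M L x = 0 ↔ (x : V) ∈ L := by
  have hspan : span ℤ (Set.range fun j => (M : ℝ) • b j) ≤ L := span_le.2 (by rintro _ ⟨j, rfl⟩; exact hSL j)
  rw [gridClass_apply, QuotientAddGroup.mk'_apply, QuotientAddGroup.eq_zero_iff, mem_gridImage_iff]
  constructor
  · rintro ⟨x', hx'L, hx'⟩
    have h0 : gridCoord b M (x - x') = 0 := by rw [map_sub, hx', sub_self]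
    have hmem := hspan ((gridCoord_eq_zero_iff_mem b M (x - x')).1 h0)
    rw [Submodule.coe_sub] at hmem
    simpa using L.add_mem hmem hx'L
  · intro hx
    exact ⟨x, hx, rfl⟩

/-- The class map is onto. [folklore] -/
theorem gridClass_surjective [NeZero M] : Function.Surjective (gridClass b M L) :=
  (QuotientAddGroup.mk'_surjective _).comp (gridCoord_surjective b M)

/-- The quotient map `ψ = mk' H` has kernel `H` (restated for the pairing with `MRCombiningQuery`).
[folklore] -/
theorem ker_mk'_gridImage : (QuotientAddGroup.mk' (gridImage b M L)).ker = gridImage b M L :=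
  QuotientAddGroup.ker_mk' _

/-- **Consistency of the sampling and combining procedures on the grid**: if `c ∈ L'` (an offset
representative) and `h ∈ H` (a lattice vector modulo `L(S)`), the representative
`w = gridRep (gridCoord c + h) ∈ P(S)` of the class `c + v mod P(S)` satisfies `c − w ∈ L` — the
hypothesis "`cᵢ − wᵢ = ((cᵢ + vᵢ) − wᵢ) − vᵢ` belongs to `L(B)`" of Lemma 5.8 (ii).
[cite: MicciancioRegev2007, Lemma 5.8 (proof of the second property, p. 21)] -/
theorem coe_sub_coe_gridRep_mem [NeZero M] (hSL : ∀ j, (M : ℝ) • b j ∈ L) (c : span ℤ (Set.range b))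
    {h : Fin n → ZMod M} (hh : h ∈ gridImage b M L) :
    (c : V) - (gridRep b M (gridCoord b M c + h) : V) ∈ L := by
  have hspan : span ℤ (Set.range fun j => (M : ℝ) • b j) ≤ L := span_le.2 (by rintro _ ⟨j, rfl⟩; exact hSL j)
  obtain ⟨x', hx'L, hx'⟩ := (mem_gridImage_iff b M L h).1 hh
  have h0 : gridCoord b M (c + x' - gridRep b M (gridCoord b M c + h)) = 0 := by
    rw [map_sub, map_add, gridCoord_gridRep, hx', sub_self]
  have hmem := hspan ((gridCoord_eq_zero_iff_mem b M _).1 h0)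
  rw [Submodule.coe_sub, Submodule.coe_add] at hmem
  have : (c : V) - (gridRep b M (gridCoord b M c + h) : V) = ((c : V) + x' - gridRep b M (gridCoord b M c + h)) - x' := by
    abel
  rw [this]
  exact L.sub_mem hmem hx'L

/-! ### Lemma 5.8 (ii), (iii) on the grid with `M = q·d` -/

/-- The basis `S = M • b` of `V` (the given short vectors), as a `Basis`. [folklore] -/
theorem isUnit_cast [NeZero M] : ∀ _j : Fin n, IsUnit (M : ℝ) := fun _ =>
  isUnit_iff_ne_zero.2 (by exact_mod_cast NeZero.ne M)

/-- Coordinates on `S = M • b` are `b`-coordinates divided by `M`. [folklore] -/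
theorem repr_isUnitSMul_eq [NeZero M] (x : V) (j : Fin n) :
    (b.isUnitSMul (isUnit_cast M)).repr x j = (M : ℝ)⁻¹ * b.repr x j := by
  rw [Basis.repr_isUnitSMul, Units.smul_def, smul_eq_mul, Units.val_inv_eq_inv_val, IsUnit.unit_spec]

/-- **The printed query is the grid rounding**: for `M = q·d` and `w = gridRep w̄`,
`⌊q · (S⁻¹ w)ⱼ⌋ = ⌊val(w̄ⱼ)/d⌋`. [cite: MicciancioRegev2007, Lemma 5.8 (step 3 of `A_F`, p. 21)] -/
theorem floor_mul_repr_gridRep (q d : ℕ) [NeZero q] [NeZero d] (w : Fin n → ZMod (q * d)) (j : Fin n) :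
    ⌊(q : ℝ) * (b.isUnitSMul (isUnit_cast (q * d))).repr (gridRep b (q * d) w : V) j⌋ =
      (((w j).val / d : ℕ) : ℤ) := by
  have hq : (q : ℝ) ≠ 0 := by exact_mod_cast NeZero.ne q
  rw [repr_isUnitSMul_eq, repr_coe_gridRep,
    show (q : ℝ) * (((q * d : ℕ) : ℝ)⁻¹ * ((w j).val : ℝ)) = ((w j).val : ℝ) / d by
      push_cast; field_simp,
    Int.floor_div_natCast, Int.floor_natCast, Int.natCast_div]

variable {m : ℕ}

/-- **MR07 Lemma 5.8 (ii) on the grid.** With `M = q·d`, offsets `cᵢ ∈ L'`, lattice classes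
`hᵢ ∈ H`, `w̄ᵢ = gridCoord cᵢ + hᵢ`, `wᵢ = gridRep w̄ᵢ`, query `aᵢⱼ = ⌊val(w̄ᵢⱼ)/d⌋` and an answer `z`
with `q ∣ ∑ᵢ zᵢ aᵢⱼ` for all `j` (`A z ≡ 0 mod q`): the output
`x = ∑ᵢ zᵢ (cᵢ − wᵢ) + q⁻¹ ∑ⱼ (∑ᵢ zᵢ aᵢⱼ) • sⱼ` lies in `L`.
[cite: MicciancioRegev2007, Lemma 5.8 (second property, p. 21)] -/
theorem combine_mem_grid (q d : ℕ) [NeZero q] [NeZero d] (hSL : ∀ j, ((q * d : ℕ) : ℝ) • b j ∈ L)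
    (c : Fin m → span ℤ (Set.range b)) {h : Fin m → Fin n → ZMod (q * d)}
    (hh : ∀ i, h i ∈ gridImage b (q * d) L) {z : Fin m → ℤ}
    (hz : ∀ j, (q : ℤ) ∣ ∑ i, z i * ((((gridCoord b (q * d) (c i) + h i) j).val / d : ℕ) : ℤ)) :
    (∑ i, (z i : ℝ) • ((c i : V) - (gridRep b (q * d) (gridCoord b (q * d) (c i) + h i) : V)) +
        (q : ℝ)⁻¹ • ∑ j, ((∑ i, z i * ((((gridCoord b (q * d) (c i) + h i) j).val / d : ℕ) : ℤ) : ℤ) : ℝ) •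
          (((q * d : ℕ) : ℝ) • b j)) ∈ L := by
  set S : Basis (Fin n) ℝ V := b.isUnitSMul (isUnit_cast (q * d)) with hS
  have hSj : ∀ j, S j = ((q * d : ℕ) : ℝ) • b j := fun j => Basis.isUnitSMul_apply _ j
  have hfl : ∀ i j, ⌊(q : ℝ) * S.repr (gridRep b (q * d) (gridCoord b (q * d) (c i) + h i) : V) j⌋ =
      ((((gridCoord b (q * d) (c i) + h i) j).val / d : ℕ) : ℤ) := fun i j =>
    floor_mul_repr_gridRep b q d _ j
  have key := combine_mem S (L := L.toAddSubgroup) (fun j => by rw [hSj]; exact hSL j)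
    (Nat.pos_of_ne_zero (NeZero.ne q)) (c := fun i => (c i : V))
    (w := fun i => (gridRep b (q * d) (gridCoord b (q * d) (c i) + h i) : V))
    (fun i => coe_sub_coe_gridRep_mem b (q * d) L hSL (c i) (hh i)) (z := z)
    (fun j => by simp_rw [hfl]; exact hz j)
  simp_rw [hfl, hSj] at key
  exact key

/-- **MR07 Lemma 5.8 (iii) on the grid**: with the same data and `‖sⱼ‖ ≤ σ`,
`‖x − ∑ᵢ zᵢ cᵢ‖ ≤ n √m ‖z‖ σ / q`. [cite: MicciancioRegev2007, Lemma 5.8 (third property, p. 21)] -/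
theorem norm_combine_sub_le_grid (q d : ℕ) [NeZero q] [NeZero d] (c : Fin m → span ℤ (Set.range b))
    (h : Fin m → Fin n → ZMod (q * d)) (z : Fin m → ℤ) {σ : ℝ}
    (hσ : ∀ j, ‖((q * d : ℕ) : ℝ) • b j‖ ≤ σ) :
    ‖(∑ i, (z i : ℝ) • ((c i : V) - (gridRep b (q * d) (gridCoord b (q * d) (c i) + h i) : V)) +
        (q : ℝ)⁻¹ • ∑ j, ((∑ i, z i * ((((gridCoord b (q * d) (c i) + h i) j).val / d : ℕ) : ℤ) : ℤ) : ℝ) •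
          (((q * d : ℕ) : ℝ) • b j)) - ∑ i, (z i : ℝ) • (c i : V)‖ ≤
      n * Real.sqrt m * ‖intVecToEuclidean m z‖ * σ / q := by
  set S : Basis (Fin n) ℝ V := b.isUnitSMul (isUnit_cast (q * d)) with hS
  have hSj : ∀ j, S j = ((q * d : ℕ) : ℝ) • b j := fun j => Basis.isUnitSMul_apply _ j
  have hfl : ∀ i j, ⌊(q : ℝ) * S.repr (gridRep b (q * d) (gridCoord b (q * d) (c i) + h i) : V) j⌋ =
      ((((gridCoord b (q * d) (c i) + h i) j).val / d : ℕ) : ℤ) := fun i j =>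
    floor_mul_repr_gridRep b q d _ j
  have key := norm_combine_sub_le_sqrt S (Nat.pos_of_ne_zero (NeZero.ne q)) (fun i => (c i : V))
    (fun i => (gridRep b (q * d) (gridCoord b (q * d) (c i) + h i) : V)) z
    (σ := σ) (fun j => by rw [hSj]; exact hσ j)
  simp_rw [hfl, hSj] at key
  exact key

end MicciancioRegev2007

end Literature.Algebra.EuclideanLattices

end
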